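import Summits.ABC.ABC.Theses.FeketeScales
import Summits.ABC.ABC.Theorems.SparseGoodScales.Negative.SqfreeForms

/-!
# `SparseGoodScales` (stmt-ABC-2161): the Chebyshev witnesses — four squarefree linear forms prime to `6`

Counting and witness algebra for `Negative/QuarticWindow.lean` (line lead c7, line `SketchIdeator4` of
the crux `Summit.ABC.ABC.Theses.FeketeScales.SparseGoodScales`), one degree above
`Negative/SqfreeForms.lean` + `Negative/CubicWindow.lean`.

The method locates the radical of any polynomial abc identity all of whose roots are RATIONAL: the
radical is then a product of linear forms in the parameter, made squarefree (hence known EXACTLY) by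
sieving.  The degree-3 totally rational identity is Chebyshev's `T₃(u) ∓ 1 = (u ∓ 1)(2u ± 1)²`, i.e.
`(u−1)(2u+1)² + 2 = (u+1)(2u−1)²`; for `u = 6(i+1)` its four linear factors are
`6i+5, 6i+7, 12i+11, 12i+13`, pairwise coprime and prime to `6`:

* `sum_primes_ge_five_inv_sq_le` — `∑_{p ≥ 5 prime} p⁻² ≤ 0.12` over any finite set;
* `card_sqfreeForms4_ge` / `exists_sqfreeForms4_Ioc` — among `i ∈ (K, K+L]` at least
  `0.52 L − 4(√(12(K+L)+13) + 1)` have all four forms squarefree (union bound over primes `p ≥ 5`,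
  `card_filter_dvd_affine_le`); one such `i` in every `(K, 2K]`, `K ≥ 2000`;
* `isABCTriple_chebyshev` — `((6i+5)(12i+13)², 2, (6i+7)(12i+11)²)` is an abc triple;
* `squarefree_chebyshev_forms` / `rad_chebyshev` — for the four forms squarefree its radical is EXACTLY
  `2 (6i+5)(6i+7)(12i+11)(12i+13)` (`≈ 8u⁴` against `c ≈ 4u³`: quality `3/4`).

All statements are folklore.
-/

noncomputable section

set_option linter.dupNamespace false

namespace Summit.ABC.ABC.Theorems.SparseGoodScales.Negative

open Literature.NumberTheory.DiophantineGeometry UniqueFactorizationMonoid Finset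

/-! ## Counting: four squarefree linear forms prime to `6` -/

/-- `∑_{p ∈ S} 1/p² ≤ 0.12` for every finite set `S` of primes `≥ 5` (`∑_{5 ≤ p < 29} p⁻² < 0.083`,
tail `≤ 1/28`). [folklore] -/
theorem sum_primes_ge_five_inv_sq_le (S : Finset ℕ) (hS : ∀ p ∈ S, p.Prime ∧ 5 ≤ p) :
    ∑ p ∈ S, (1 : ℝ) / (p : ℝ) ^ 2 ≤ 0.12 := by
  classical
  rw [← Finset.sum_filter_add_sum_filter_not S (fun p => p < 29)]
  have h1 : ∑ p ∈ S.filter (fun p => p < 29), (1 : ℝ) / (p : ℝ) ^ 2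
      ≤ ∑ p ∈ (Finset.range 29).filter (fun p => Nat.Prime p ∧ 5 ≤ p), (1 : ℝ) / (p : ℝ) ^ 2 := by
    apply Finset.sum_le_sum_of_subset_of_nonneg
    · intro p hp
      rw [Finset.mem_filter] at hp ⊢
      exact ⟨Finset.mem_range.2 hp.2, hS p hp.1⟩
    · intro _ _ _
      positivity
  have h2 : ∑ p ∈ (Finset.range 29).filter (fun p => Nat.Prime p ∧ 5 ≤ p), (1 : ℝ) / (p : ℝ) ^ 2
      ≤ 0.083 := by
    rw [Finset.sum_filter]
    simp only [Finset.sum_range_succ, Finset.sum_range_zero]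
    norm_num
  have h3 : ∑ p ∈ S.filter (fun p => ¬p < 29), (1 : ℝ) / (p : ℝ) ^ 2 ≤ 1 / ((28 : ℕ) : ℝ) := by
    have hsub : S.filter (fun p => ¬p < 29) ⊆ Finset.Icc (28 + 1) (S.sup id) := by
      intro p hp
      rw [Finset.mem_filter] at hp
      rw [Finset.mem_Icc]
      exact ⟨by omega, Finset.le_sup (f := id) hp.1⟩
    calc ∑ p ∈ S.filter (fun p => ¬p < 29), (1 : ℝ) / (p : ℝ) ^ 2
        ≤ ∑ k ∈ Finset.Icc (28 + 1) (S.sup id), (1 : ℝ) / (k : ℝ) ^ 2 :=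
          Finset.sum_le_sum_of_subset_of_nonneg hsub fun _ _ _ => by positivity
      _ ≤ 1 / ((28 : ℕ) : ℝ) :=
          Literature.Barriers.Parity.MRTCounterexample.sum_Icc_inv_sq_le 28 _ (by norm_num)
  have h4 : (1 : ℝ) / ((28 : ℕ) : ℝ) ≤ 0.036 := by norm_num
  linarith

/-- **Four squarefree linear forms prime to `6`, with an effective count.**  Among `i ∈ (K, K+L]` at
least `0.52 L − 4 (⌊√(12(K+L)+13)⌋ + 1)` have `6i+5`, `6i+7`, `12i+11`, `12i+13` all squarefree: a
non-squarefree value prime to `6` is divisible by `p²` for a prime `5 ≤ p ≤ √(12(K+L)+13)`, each such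
event has at most `L/p² + 1` solutions (`card_filter_dvd_affine_le`), and `4 ∑_{p ≥ 5} p⁻² ≤ 0.48`.
[folklore] -/
theorem card_sqfreeForms4_ge (K L : ℕ) :
    (52 : ℝ) / 100 * L - 4 * ((Nat.sqrt (12 * (K + L) + 13) : ℝ) + 1) ≤
      #{i ∈ Ioc K (K + L) | Squarefree (6 * i + 5) ∧ Squarefree (6 * i + 7) ∧
        Squarefree (12 * i + 11) ∧ Squarefree (12 * i + 13)} := by
  classical
  set S := Ioc K (K + L) with hSdef
  set T := Nat.sqrt (12 * (K + L) + 13) with hTdef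
  set G : ℕ → Prop := fun i => Squarefree (6 * i + 5) ∧ Squarefree (6 * i + 7) ∧
    Squarefree (12 * i + 11) ∧ Squarefree (12 * i + 13) with hGdef
  have hcard : #{i ∈ S | G i} + #{i ∈ S | ¬G i} = L := by
    rw [Finset.card_filter_add_card_filter_not, hSdef, Nat.card_Ioc]
    omega
  set P := (Nat.primesLE T).filter (fun p => 5 ≤ p) with hPdef
  set F : ℕ → Finset ℕ := fun p =>
    ((S.filter (fun i => p * p ∣ 6 * i + 5) ∪ S.filter (fun i => p * p ∣ 6 * i + 7)) ∪
      S.filter (fun i => p * p ∣ 12 * i + 11)) ∪ S.filter (fun i => p * p ∣ 12 * i + 13) with hFdef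
  -- every bad `i` is caught by a prime `p ≥ 5` whose square divides one of the four forms
  have hbad : S.filter (fun i => ¬G i) ⊆ P.biUnion F := by
    intro i hi
    rw [Finset.mem_filter] at hi
    obtain ⟨hiS, hiG⟩ := hi
    have hiS' : K < i ∧ i ≤ K + L := by simpa [hSdef] using hiS
    have key : ∀ a b : ℕ, a * i + b ≤ 12 * (K + L) + 13 → ¬ 2 ∣ a * i + b → ¬ 3 ∣ a * i + b →
        ¬Squarefree (a * i + b) → ∃ p ∈ P, p * p ∣ a * i + b := by
      intro a b hle h2 h3 hns
      rw [Nat.squarefree_iff_prime_squarefree] at hns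
      push Not at hns
      obtain ⟨p, hp, hdvd⟩ := hns
      refine ⟨p, ?_, hdvd⟩
      rw [hPdef, Finset.mem_filter, Nat.mem_primesLE]
      have hpos : 0 < a * i + b := Nat.pos_of_ne_zero fun h0 => h2 (h0 ▸ dvd_zero 2)
      have hpd : p ∣ a * i + b := dvd_trans ⟨p, rfl⟩ hdvd
      refine ⟨⟨?_, hp⟩, ?_⟩
      · rw [hTdef, Nat.le_sqrt]
        exact le_trans (Nat.le_of_dvd hpos hdvd) hle
      · have hp2 : p ≠ 2 := fun h => h2 (h ▸ hpd)
        have hp3 : p ≠ 3 := fun h => h3 (h ▸ hpd)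
        have := hp.two_le
        by_contra hlt
        interval_cases p
        · exact hp2 rfl
        · exact hp3 rfl
        · exact absurd hp (by norm_num)
    rw [Finset.mem_biUnion]
    have hiG' : ¬Squarefree (6 * i + 5) ∨ ¬Squarefree (6 * i + 7) ∨ ¬Squarefree (12 * i + 11) ∨
        ¬Squarefree (12 * i + 13) := by
      simp only [hGdef] at hiG
      tauto
    rcases hiG' with h | h | h | h
    · obtain ⟨p, hp, hd⟩ := key 6 5 (by omega) (by omega) (by omega) h
      exact ⟨p, hp, Finset.mem_union.2 (Or.inl (Finset.mem_union.2 (Or.inl (Finset.mem_union.2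
        (Or.inl (Finset.mem_filter.2 ⟨hiS, hd⟩))))))⟩
    · obtain ⟨p, hp, hd⟩ := key 6 7 (by omega) (by omega) (by omega) h
      exact ⟨p, hp, Finset.mem_union.2 (Or.inl (Finset.mem_union.2 (Or.inl (Finset.mem_union.2
        (Or.inr (Finset.mem_filter.2 ⟨hiS, hd⟩))))))⟩
    · obtain ⟨p, hp, hd⟩ := key 12 11 (by omega) (by omega) (by omega) h
      exact ⟨p, hp, Finset.mem_union.2 (Or.inl (Finset.mem_union.2
        (Or.inr (Finset.mem_filter.2 ⟨hiS, hd⟩))))⟩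
    · obtain ⟨p, hp, hd⟩ := key 12 13 (by omega) (by omega) (by omega) h
      exact ⟨p, hp, Finset.mem_union.2 (Or.inr (Finset.mem_filter.2 ⟨hiS, hd⟩))⟩
  have hPcard : (#P : ℝ) ≤ (T : ℝ) + 1 := by
    have h1 : P ⊆ Finset.range (T + 1) := by
      intro p hp
      rw [hPdef, Finset.mem_filter, Nat.mem_primesLE] at hp
      exact Finset.mem_range.2 (Nat.lt_succ_of_le hp.1.1)
    have h2 := Finset.card_le_card h1
    rw [Finset.card_range] at h2
    exact_mod_cast h2
  have hPsum : ∑ p ∈ P, (1 : ℝ) / (p : ℝ) ^ 2 ≤ 0.12 := by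
    refine sum_primes_ge_five_inv_sq_le P fun p hp => ?_
    rw [hPdef, Finset.mem_filter] at hp
    exact ⟨Nat.prime_of_mem_primesLE hp.1, hp.2⟩
  have hbadcard : ((#(S.filter (fun i => ¬G i)) : ℕ) : ℝ) ≤ 4 * (L : ℝ) * 0.12 + 4 * ((T : ℝ) + 1) := by
    calc ((#(S.filter (fun i => ¬G i)) : ℕ) : ℝ)
        ≤ #(P.biUnion F) := by exact_mod_cast Finset.card_le_card hbad
      _ ≤ ∑ p ∈ P, ((#(F p) : ℕ) : ℝ) := by exact_mod_cast Finset.card_biUnion_le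
      _ ≤ ∑ p ∈ P, (4 * (L : ℝ) * ((1 : ℝ) / (p : ℝ) ^ 2) + 4) := by
          refine Finset.sum_le_sum fun p hp => ?_
          rw [hPdef, Finset.mem_filter] at hp
          have hpp : p.Prime := Nat.prime_of_mem_primesLE hp.1
          have hp5 : 5 ≤ p := hp.2
          have hpos : 0 < p * p := Nat.mul_pos hpp.pos hpp.pos
          have hc2 : Nat.Coprime p 2 := (Nat.coprime_primes hpp Nat.prime_two).mpr (by omega)
          have hc3 : Nat.Coprime p 3 := (Nat.coprime_primes hpp Nat.prime_three).mpr (by omega)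
          have hc6 : Nat.Coprime p 6 := by simpa using Nat.Coprime.mul_right hc2 hc3
          have hc12 : Nat.Coprime p 12 := by simpa using Nat.Coprime.mul_right hc2 hc6
          have hcop6 : Nat.Coprime (p * p) 6 := Nat.Coprime.mul_left hc6 hc6
          have hcop12 : Nat.Coprime (p * p) 12 := Nat.Coprime.mul_left hc12 hc12
          have h1 := card_filter_dvd_affine_le K L (p * p) 6 5 hpos hcop6
          have h2 := card_filter_dvd_affine_le K L (p * p) 6 7 hpos hcop6
          have h3 := card_filter_dvd_affine_le K L (p * p) 12 11 hpos hcop12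
          have h4 := card_filter_dvd_affine_le K L (p * p) 12 13 hpos hcop12
          have hU : #(F p) ≤ #(S.filter (fun i => p * p ∣ 6 * i + 5)) +
              #(S.filter (fun i => p * p ∣ 6 * i + 7)) + #(S.filter (fun i => p * p ∣ 12 * i + 11)) +
              #(S.filter (fun i => p * p ∣ 12 * i + 13)) := by
            rw [hFdef]
            refine le_trans (Finset.card_union_le _ _) (Nat.add_le_add_right ?_ _)
            exact le_trans (Finset.card_union_le _ _)
              (Nat.add_le_add_right (Finset.card_union_le _ _) _)
          have hU' : ((#(F p) : ℕ) : ℝ) ≤ ((#(S.filter (fun i => p * p ∣ 6 * i + 5)) : ℕ) : ℝ) +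
              ((#(S.filter (fun i => p * p ∣ 6 * i + 7)) : ℕ) : ℝ) +
              ((#(S.filter (fun i => p * p ∣ 12 * i + 11)) : ℕ) : ℝ) +
              ((#(S.filter (fun i => p * p ∣ 12 * i + 13)) : ℕ) : ℝ) := by exact_mod_cast hU
          have hpp' : ((p * p : ℕ) : ℝ) = (p : ℝ) ^ 2 := by push_cast; ring
          rw [hSdef] at hU'
          rw [hpp'] at h1 h2 h3 h4
          have : (L : ℝ) / (p : ℝ) ^ 2 = (L : ℝ) * (1 / (p : ℝ) ^ 2) := by ring
          rw [this] at h1 h2 h3 h4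
          linarith
      _ = 4 * (L : ℝ) * ∑ p ∈ P, (1 : ℝ) / (p : ℝ) ^ 2 + 4 * (#P : ℝ) := by
          rw [Finset.sum_add_distrib, Finset.sum_const, ← Finset.mul_sum]
          simp [nsmul_eq_mul]
          ring
      _ ≤ 4 * (L : ℝ) * 0.12 + 4 * ((T : ℝ) + 1) := by
          have hL : (0 : ℝ) ≤ 4 * (L : ℝ) := by positivity
          nlinarith [hPsum, hPcard, hL]
  have hgood : ((#{i ∈ S | G i} : ℕ) : ℝ) = L - #{i ∈ S | ¬G i} := by
    have := congrArg (Nat.cast (R := ℝ)) hcard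
    push_cast at this
    linarith
  rw [hgood]
  linarith

/-- **Four squarefree forms in `(K, 2K]`.**  For `K ≥ 2000` some `i ∈ (K, 2K]` has `6i+5`, `6i+7`,
`12i+11`, `12i+13` all squarefree (`0.52 K > 4 (√(24K+13) + 1)`). [folklore] -/
theorem exists_sqfreeForms4_Ioc {K : ℕ} (hK : 2000 ≤ K) :
    ∃ i : ℕ, K < i ∧ i ≤ K + K ∧ Squarefree (6 * i + 5) ∧ Squarefree (6 * i + 7) ∧
      Squarefree (12 * i + 11) ∧ Squarefree (12 * i + 13) := by
  classical
  have h := card_sqfreeForms4_ge K K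
  set s := Nat.sqrt (12 * (K + K) + 13) with hs
  have hs2 : ((s : ℕ) : ℝ) ^ 2 ≤ 12 * ((K : ℝ) + K) + 13 := by
    have h1 : s * s ≤ 12 * (K + K) + 13 := Nat.sqrt_le _
    have h2 : ((s * s : ℕ) : ℝ) ≤ ((12 * (K + K) + 13 : ℕ) : ℝ) := by exact_mod_cast h1
    push_cast at h2
    nlinarith [h2]
  have hK' : (2000 : ℝ) ≤ K := by exact_mod_cast hK
  have hs0 : (0 : ℝ) ≤ s := Nat.cast_nonneg s
  have hpos : (0 : ℝ) < (52 : ℝ) / 100 * K - 4 * ((s : ℝ) + 1) := by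
    by_contra hcon
    push Not at hcon
    have h1 : (52 : ℝ) / 100 * K - 4 ≤ 4 * s := by linarith
    have h0 : (0 : ℝ) ≤ (52 : ℝ) / 100 * K - 4 := by linarith
    have h2 : ((52 : ℝ) / 100 * K - 4) ^ 2 ≤ (4 * (s : ℝ)) ^ 2 := pow_le_pow_left₀ h0 h1 2
    nlinarith [h2, hs2, hK', mul_nonneg (sub_nonneg.2 hK') (by norm_num : (0 : ℝ) ≤ 2704 / 10000)]
  have hcard : 0 < #{i ∈ Ioc K (K + K) | Squarefree (6 * i + 5) ∧ Squarefree (6 * i + 7) ∧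
      Squarefree (12 * i + 11) ∧ Squarefree (12 * i + 13)} := by
    have : (0 : ℝ) < #{i ∈ Ioc K (K + K) | Squarefree (6 * i + 5) ∧ Squarefree (6 * i + 7) ∧
        Squarefree (12 * i + 11) ∧ Squarefree (12 * i + 13)} := lt_of_lt_of_le hpos h
    exact_mod_cast this
  obtain ⟨i, hi⟩ := Finset.card_pos.mp hcard
  rw [Finset.mem_filter, Finset.mem_Ioc] at hi
  exact ⟨i, hi.1.1, hi.1.2, hi.2.1, hi.2.2.1, hi.2.2.2.1, hi.2.2.2.2⟩

/-! ## The Chebyshev witnesses `((u−1)(2u+1)², 2, (u+1)(2u−1)²)`, `u = 6i + 6` -/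

/-- `((6i+5)(12i+13)², 2, (6i+7)(12i+11)²)` is an abc triple (`T₃(u) − 1 + 2 = T₃(u) + 1` at
`u = 6i+6`). [folklore] -/
theorem isABCTriple_chebyshev (i : ℕ) :
    IsABCTriple ((6 * i + 5) * (12 * i + 13) ^ 2) 2 ((6 * i + 7) * (12 * i + 11) ^ 2) := by
  refine ⟨by positivity, two_pos, by ring, ?_⟩
  refine ((Nat.Prime.coprime_iff_not_dvd Nat.prime_two).mpr ?_).symm
  intro h2
  rcases (Nat.Prime.dvd_mul Nat.prime_two).mp h2 with h | h
  · omega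
  · have := Nat.Prime.dvd_of_dvd_pow Nat.prime_two h
    omega

/-- The product of the four forms is squarefree when each is: they are pairwise coprime
(`gcd`s divide `2`, `3`, `1`, and all four are prime to `6`). [folklore] -/
theorem squarefree_chebyshev_forms {i : ℕ} (h1 : Squarefree (6 * i + 5)) (h2 : Squarefree (6 * i + 7))
    (h3 : Squarefree (12 * i + 11)) (h4 : Squarefree (12 * i + 13)) :
    Squarefree (2 * ((6 * i + 5) * (6 * i + 7) * ((12 * i + 11) * (12 * i + 13)))) := by
  have g1 : Nat.Coprime (6 * i + 5) (6 * i + 7) := by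
    rw [show 6 * i + 7 = (6 * i + 5) + 2 by ring, Nat.coprime_self_add_right]
    exact ((Nat.Prime.coprime_iff_not_dvd Nat.prime_two).mpr (by omega)).symm
  have g2 : Nat.Coprime (12 * i + 11) (12 * i + 13) := by
    rw [show 12 * i + 13 = (12 * i + 11) + 2 by ring, Nat.coprime_self_add_right]
    exact ((Nat.Prime.coprime_iff_not_dvd Nat.prime_two).mpr (by omega)).symm
  have g3 : Nat.Coprime (6 * i + 5) (12 * i + 11) := by
    rw [show 12 * i + 11 = (6 * i + 5) * 2 + 1 by ring, Nat.coprime_mul_left_add_right]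
    exact Nat.coprime_one_right _
  have g4 : Nat.Coprime (6 * i + 5) (12 * i + 13) := by
    rw [show 12 * i + 13 = (6 * i + 5) * 2 + 3 by ring, Nat.coprime_mul_left_add_right]
    exact ((Nat.Prime.coprime_iff_not_dvd Nat.prime_three).mpr (by omega)).symm
  have g5 : Nat.Coprime (6 * i + 7) (12 * i + 11) := by
    have : Nat.Coprime (12 * i + 11) (6 * i + 7) := by
      rw [show 12 * i + 11 = (6 * i + 4) + (6 * i + 7) by ring, Nat.coprime_add_self_left,
        show 6 * i + 7 = (6 * i + 4) + 3 by ring, Nat.coprime_self_add_right]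
      exact ((Nat.Prime.coprime_iff_not_dvd Nat.prime_three).mpr (by omega)).symm
    exact this.symm
  have g6 : Nat.Coprime (6 * i + 7) (12 * i + 13) := by
    have : Nat.Coprime (12 * i + 13) (6 * i + 7) := by
      rw [show 12 * i + 13 = (6 * i + 6) + (6 * i + 7) by ring, Nat.coprime_add_self_left,
        show 6 * i + 7 = (6 * i + 6) + 1 by ring, Nat.coprime_self_add_right]
      exact Nat.coprime_one_right _
    exact this.symm
  have hA : Squarefree ((6 * i + 5) * (6 * i + 7)) := Nat.squarefree_mul_iff.mpr ⟨g1, h1, h2⟩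
  have hB : Squarefree ((12 * i + 11) * (12 * i + 13)) := Nat.squarefree_mul_iff.mpr ⟨g2, h3, h4⟩
  have hAB : Squarefree ((6 * i + 5) * (6 * i + 7) * ((12 * i + 11) * (12 * i + 13))) :=
    Nat.squarefree_mul_iff.mpr
      ⟨Nat.Coprime.mul_left (Nat.Coprime.mul_right g3 g4) (Nat.Coprime.mul_right g5 g6), hA, hB⟩
  refine Nat.squarefree_mul_iff.mpr ⟨?_, Nat.prime_two.prime.squarefree, hAB⟩
  have c2 : ∀ n : ℕ, ¬ 2 ∣ n → Nat.Coprime 2 n := fun n hn =>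
    (Nat.Prime.coprime_iff_not_dvd Nat.prime_two).mpr hn
  exact Nat.Coprime.mul_right (Nat.Coprime.mul_right (c2 _ (by omega)) (c2 _ (by omega)))
    (Nat.Coprime.mul_right (c2 _ (by omega)) (c2 _ (by omega)))

/-- For the four forms squarefree, the radical of the Chebyshev triple is EXACTLY
`2 (6i+5)(6i+7)(12i+11)(12i+13)`. [folklore] -/
theorem rad_chebyshev {i : ℕ} (hsq : Squarefree (2 * ((6 * i + 5) * (6 * i + 7) *
    ((12 * i + 11) * (12 * i + 13))))) :
    rad ((6 * i + 5) * (12 * i + 13) ^ 2) 2 ((6 * i + 7) * (12 * i + 11) ^ 2) =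
      2 * ((6 * i + 5) * (6 * i + 7) * ((12 * i + 11) * (12 * i + 13))) := by
  set P := 2 * ((6 * i + 5) * (6 * i + 7) * ((12 * i + 11) * (12 * i + 13))) with hP
  set Q := (12 * i + 11) * (12 * i + 13) with hQ
  have hP0 : P ≠ 0 := hsq.ne_zero
  have hQ0 : Q ≠ 0 := by positivity
  have hQP : Q ∣ P := ⟨2 * ((6 * i + 5) * (6 * i + 7)), by rw [hP, hQ]; ring⟩
  have hprod : (6 * i + 5) * (12 * i + 13) ^ 2 * 2 * ((6 * i + 7) * (12 * i + 11) ^ 2) = P * Q := by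
    rw [hP, hQ]; ring
  rw [rad_def, hprod, Nat.radical_eq_prod_primeFactors, Nat.primeFactors_mul hP0 hQ0,
    Finset.union_eq_left.2 (Nat.primeFactors_mono hQP hP0), Nat.prod_primeFactors_of_squarefree hsq]

end Summit.ABC.ABC.Theorems.SparseGoodScales.Negative
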